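import Literature.NumberTheory.Transcendental.KZSemialgebraicComplex
import Mathlib.MeasureTheory.Integral.Pi
import Mathlib.MeasureTheory.Function.LocallyIntegrable
import Mathlib.Analysis.SpecialFunctions.Sqrt
import HarnessLib

/-!
# Genus-one iterated integrals on the real oval as Kontsevich–Zagier representations

Definition request `defn-ellIterRep` (route KontsevichZagierPeriods/GenusOneIterated; wanted by
`stmt-KontsevichZagierPeriods-7185` EllGeneration and `-7187` GenusOneSectorAssembly), the
genus-one companion of `MZVSimplexRep.lean` (`KZ.mzvRep`).

**The objects.** A real cubic `E : y² = f(x) = 4(x − e₁)(x − e₂)(x − e₃)` with real algebraic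
roots `e₃ < e₂ < e₁` (`KZ.EllCurve`; `f > 0` on `(e₃, e₂)`, whose closure carries the bounded
real oval of `E(ℝ)` with its 2-torsion points `(e₃, 0)`, `(e₂, 0)`). A *monotone arc* `γ` of the
oval (`KZ.EllArc E`): algebraic abscissae `e₃ ≤ lo < hi ≤ e₂`, a sheet (`y = +√f` or `y = −√f`)
and an orientation (traversed with increasing or with decreasing `x`). *Letters* (`KZ.EllLetter`):
the algebraic `1`-forms `x^j dx/y` (`j = 0`: `ω = dx/y` of the first kind; `j = 1`: `η = x dx/y`
of the second kind; `j = 2`: `x² dx/y`) and, for a real algebraic point `P = (x_P, y_P)` whose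
abscissa lies off the closed `x`-range `[lo, hi]` of the arc, the third-kind form
`(y + y_P) dx / (2 (x − x_P) y)` (for `P ∈ E` this is the classical differential of the third
kind with simple poles at `P` and `O`: by the addition theorem
`ζ(u + v) = ζ(u) + ζ(v) + ½ (℘'u − ℘'v)/(℘u − ℘v)` (Lawden 1989, (6.8.4)) its kernel is
`(y + y_P)/(2(x − x_P)) = ζ(z − z_P) − ζ(z) + ζ(z_P)` for `(x, y) = (℘z, ℘'z)`,
`(x_P, y_P) = (℘z_P, ℘'z_P)`; Lawden 1989, §6.12 (6.12.25), §6.13, §6.14 for the real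
first-, second- and third-kind integrals over `(e₃, e₂)` in exactly these coordinates).

**The representation.** For a word `w = (φ₀, …, φ_{n−1})` (`w : Fin n → EllLetter`) adapted to
`γ` (`KZ.EllArc.Adapted`: the poles of its third-kind letters are off `[lo, hi]`),
`KZ.ellIterRep γ w hw : KZ.IntegralRep n` is the datum

* domain `KZ.ellDomain γ n = {x ∈ ℝⁿ | lo < xᵢ < hi, x strictly increasing}` for a forward arc
  (strictly decreasing for a backward arc) — the open ordered simplex in the `x`-coordinates,
  ordered by the arc;
* integrand `KZ.ellIntegrand γ w x = σⁿ ∏ₖ φₖ(xₖ)`, each letter written in the coordinate `x` on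
  the chosen sheet (`KZ.EllLetter.density`: `x^j / y(x)`, resp. `(y(x) + y_P)/(2(x − x_P) y(x))`,
  `y(x) = ±√f(x)`), `σ = ±1` the orientation sign (the factor `dx = σ |dx|` of each letter);

so that its value `∫_{domain} integrand` is the iterated integral `∫_γ φ₀ φ₁ ⋯ φ_{n−1}` in
Chen's sense, `∫_{0<t₀<⋯<t_{n−1}<1} ∏ₖ γ*φₖ(tₖ)` — first letter nearest the beginning of the path,
i.e. innermost:
`∫_γ φ₀ ⋯ φ_{n−1} = ∫_{lo}^{hi} φ_{n−1}(x_{n−1}) ∫_{lo}^{x_{n−1}} ⋯ ∫_{lo}^{x₁} φ₀(x₀)` for a forward arc (Chen 1977, §1.1 (1.1.1): `∫ f₁dt ⋯ f_r dt = ∫ₐᵇ (∫ₐᵗ f₁ ⋯ f_{r−1}) f_r(t) dt`,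
"when `r = 0`, set the integral to be `1`"; Kontsevich–Zagier 2001, §1.1 for the simplex form
of an iterated integral as a period; the empty word has the one-point domain `ℝ⁰`, value `1`).
This is the convention of the route's items (`I(ωωη) = ∫_{e₃<x₀<x₁<x₂<e₂} x₂/(y₀y₁y₂)`,
`I(ωη) − I(ηω) = ∫ (x₁ − x₀)/(y₀y₁)`).

**What is proved here** (the three fields of `IntegralRep`, no hypotheses left over):
* `KZ.isSemialgebraic_ellDomain` — the domain is `ℚ`-semialgebraic (real algebraic constants
  are `ℚ`-definable, `isSemialgebraicFunOn_const_of_isAlgebraic`);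
* `KZ.isSemialgebraicFunOn_ellIntegrand` — the integrand is a `ℚ`-semialgebraic function on the
  domain (closure of real semialgebraic functions under `+`, `*`, `/`, `√`, all PROVED in the
  tree from Tarski–Seidenberg: `IsSemialgebraicFunOn.mul_holds`, `.div`, `.sqrt_holds`);
* `KZ.integrableOn_ellIntegrand` — absolute convergence: every letter is absolutely integrable
  on `(lo, hi)` (`KZ.integrableOn_density`; the only singularities are the inverse square roots
  `(x − e₃)^{-1/2}`, `(e₂ − x)^{-1/2}` at 2-torsion endpoints,
  `KZ.EllCurve.integrableOn_inv_sqrt_f`, the third-kind poles being off `[lo, hi]`), hence the product is integrable on the box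
  `(lo, hi)ⁿ ⊇ domain` (`MeasureTheory.Integrable.fintype_prod`);
and the API: unfolding lemmas, membership in the domain for forward/backward arcs, the domain is
non-empty (`KZ.ellDomain_nonempty`), and the pointwise content of PATH REVERSAL
(`KZ.EllArc.reverse`, `KZ.mem_ellDomain_reverse_iff`, `KZ.ellIntegrand_reverse`:
`∫_{γ⁻¹} φ₀⋯φ_{n−1} = (−1)ⁿ ∫_γ φ_{n−1}⋯φ₀` on the nose of domains and integrands under the
coordinate reversal `x ↦ x ∘ Fin.rev`; Chen 1977, (1.6.2); Goncharov 2005, Prop. 2.1).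

**Not included** (they are statements about `KZ.relations`, to be filed as route items exactly
like `CoactionDevissage.Shuffle` for `mzvRep`, and proved by provers with the moves of
`KZCalculus.lean`): Chen's composition formula (Chen 1977, (1.6.1)) for an arc split at an
algebraic abscissa (domain additivity into the cells `{x_{k−1} < c < x_k}` = products
`Δ_k × Δ_{n−k}`, `KZ.of_mul_of`), the shuffle product formula (Chen 1977, (1.5.6); Ree)
`[I_γ(u)][I_γ(v)] = Σ_{w ∈ u ш v} [I_γ(w)]` (`MZV.shuffleWord` applies verbatim to
`List EllLetter`; domain additivity of `Δ_p × Δ_q` and coordinate permutations), and path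
reversal (Chen 1977, (1.6.2)) as a change-of-variables move; likewise the nested-integral
(Fubini) form of the value. Arcs through `O` (tangential base points), the
unbounded component, and points `P` of the opposite sheet over `(lo, hi)` (removable
singularity of the third-kind letter) are deliberately out of scope.

## References

* K.-T. Chen, *Iterated path integrals*, Bull. Amer. Math. Soc. 83 (1977), 831–879: §1.1
  (1.1.1) (iterated line integrals, defined inductively with the last letter outermost),
  (1.5.6) (shuffle product, after Ree), §1.6 (1.6.1) (product path `αβ`), (1.6.2) (inverse
  path `α⁻¹`). [Chen1977]
* M. Kontsevich, D. Zagier, *Periods* (2001), §1.1 (periods as absolutely convergent integrals of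
  algebraic functions over semialgebraic domains; iterated-integral / simplex representations).
* A. B. Goncharov, *Galois symmetries of fundamental groupoids and noncommutative geometry*,
  Duke Math. J. 128 (2005), §2.1, Prop. 2.1 (reversal
  `I(a₀; …; a_{m+1}) = (−1)^m I(a_{m+1}; …; a₀)`).
* D. F. Lawden, *Elliptic Functions and Applications* (1989), §6.8 (6.8.4) (addition theorem
  for `ζ`: the third-kind kernel), §6.12 (6.12.25) (the eight real canonical first-kind
  integrals `½∫{(e₁−s)(e₂−s)(s−e₃)}^{-1/2} ds`, among them those over `[e₃, e₂]`), §6.13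
  (second kind), §6.14 (6.14.1) (third kind). [Lawden1989]
* J. Bochnak, M. Coste, M.-F. Roy, *Real Algebraic Geometry* (1998), §2.2.

## Design notes

* Words are vectors `Fin n → EllLetter` (as the coordinates of `mzvIntegrand` are indexed by
  `Fin (weight s)`), so that `ellIterRep γ ![ω, ω, η] _ : IntegralRep 3` on the nose; for list
  words use `fun k => l.get k`. Letter `k` sits at coordinate `k`.
* Orientation and sheet are Booleans (`forward`, `upper`); the associated signs `orSign`,
  `sheetSign ∈ {1, −1}` enter the integrand, the orientation also the order of the simplex.
* The pole condition of a third-kind letter is `x_P ∉ [lo, hi]` (abscissa off the closed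
  `x`-range of the arc): this covers every algebraic point off the bounded oval (`x_P ≥ e₁` or
  `P ∉ E(ℝ)`), which is what the requesting items use; the coordinates of `P` are required real
  algebraic (for `ℚ`-semialgebraicity) but `P ∈ E` is not required (nothing here depends on it).
* Mathlib has no iterated integrals (searched `iteratedIntegral`, `Chen`, `IteratedIntegral`);
  the tree has Kontsevich's simplex representation of MZVs (`KZ.mzvRep`) and Goncharov's formal
  symbols (`GoncharovFormalIteratedIntegrals.lean`), nothing in genus one.
-/

noncomputable section

open MeasureTheory Set MvPolynomial
open Literature.ModelTheory.ExponentialFields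

namespace Literature.NumberTheory.Transcendental

namespace KZ

/-! ### The real cubic and its oval -/

/-- A real cubic `y² = f(x) = 4 (x − e₁)(x − e₂)(x − e₃)` in Weierstrass–Legendre form with three
real algebraic roots `e₃ < e₂ < e₁` (equivalently `g₂, g₃` algebraic with positive discriminant
when `e₁ + e₂ + e₃ = 0`, which is NOT imposed here): the real locus has the bounded oval over
`[e₃, e₂]` (where `f ≥ 0`) and the unbounded branch over `[e₁, ∞)`.
[Lawden 1989, §6.12 (6.12.25); Kontsevich–Zagier 2001, §1.1] [cite: Lawden1989, §6.12 (6.12.25)] -/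
structure EllCurve where
  /-- The largest root `e₁` of `f`. -/
  e₁ : ℝ
  /-- The middle root `e₂` of `f` (right end of the oval). -/
  e₂ : ℝ
  /-- The smallest root `e₃` of `f` (left end of the oval). -/
  e₃ : ℝ
  isAlgebraic_e₁ : IsAlgebraic ℚ e₁
  isAlgebraic_e₂ : IsAlgebraic ℚ e₂
  isAlgebraic_e₃ : IsAlgebraic ℚ e₃
  e₃_lt_e₂ : e₃ < e₂
  e₂_lt_e₁ : e₂ < e₁

namespace EllCurve

variable (E : EllCurve)

/-- The cubic `f(x) = 4 (x − e₁)(x − e₂)(x − e₃)` (so `E : y² = f(x)`). [Lawden 1989, §6.12]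
[cite: Lawden1989, §6.12 (6.12.25)] -/
def f (x : ℝ) : ℝ := 4 * (x - E.e₁) * (x - E.e₂) * (x - E.e₃)

/-- `f(x) = 4 (e₁ − x)(e₂ − x)(x − e₃)`, the form exhibiting positivity on the oval. [folklore] -/
theorem f_eq (x : ℝ) : E.f x = 4 * ((E.e₁ - x) * ((E.e₂ - x) * (x - E.e₃))) := by
  unfold f; ring

/-- `f > 0` on the open oval range `(e₃, e₂)`. [folklore] -/
theorem f_pos {x : ℝ} (h₃ : E.e₃ < x) (h₂ : x < E.e₂) : 0 < E.f x := by
  rw [f_eq]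
  exact mul_pos four_pos (mul_pos (sub_pos.2 (h₂.trans E.e₂_lt_e₁))
    (mul_pos (sub_pos.2 h₂) (sub_pos.2 h₃)))

/-- `f` is continuous. [folklore] -/
theorem continuous_f : Continuous E.f := by
  unfold f; fun_prop

/-- **Lower bound on the oval.** With `K = 2 (e₁ − e₂)(e₂ − e₃) > 0`, for `x ∈ (e₃, e₂)` one has
`K · min (x − e₃) (e₂ − x) ≤ f(x)`; stated as the two cases. [folklore] -/
theorem const_mul_le_f {x : ℝ} (h₃ : E.e₃ < x) (h₂ : x < E.e₂) :
    (x - E.e₃ ≤ E.e₂ - x → 2 * (E.e₁ - E.e₂) * (E.e₂ - E.e₃) * (x - E.e₃) ≤ E.f x) ∧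
    (E.e₂ - x ≤ x - E.e₃ → 2 * (E.e₁ - E.e₂) * (E.e₂ - E.e₃) * (E.e₂ - x) ≤ E.f x) := by
  have h₁ : x < E.e₁ := h₂.trans E.e₂_lt_e₁
  have ha : E.e₁ - E.e₂ ≤ E.e₁ - x := by linarith
  refine ⟨fun h => ?_, fun h => ?_⟩
  · have hb : E.e₂ - E.e₃ ≤ 2 * (E.e₂ - x) := by linarith
    have hab : (E.e₁ - E.e₂) * (E.e₂ - E.e₃) ≤ (E.e₁ - x) * (2 * (E.e₂ - x)) :=
      mul_le_mul ha hb (by linarith [E.e₃_lt_e₂]) (by linarith)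
    calc 2 * (E.e₁ - E.e₂) * (E.e₂ - E.e₃) * (x - E.e₃)
        = 2 * (x - E.e₃) * ((E.e₁ - E.e₂) * (E.e₂ - E.e₃)) := by ring
      _ ≤ 2 * (x - E.e₃) * ((E.e₁ - x) * (2 * (E.e₂ - x))) :=
          mul_le_mul_of_nonneg_left hab (by linarith)
      _ = E.f x := by rw [f_eq]; ring
  · have hb : E.e₂ - E.e₃ ≤ 2 * (x - E.e₃) := by linarith
    have hab : (E.e₁ - E.e₂) * (E.e₂ - E.e₃) ≤ (E.e₁ - x) * (2 * (x - E.e₃)) :=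
      mul_le_mul ha hb (by linarith [E.e₃_lt_e₂]) (by linarith)
    calc 2 * (E.e₁ - E.e₂) * (E.e₂ - E.e₃) * (E.e₂ - x)
        = 2 * (E.e₂ - x) * ((E.e₁ - E.e₂) * (E.e₂ - E.e₃)) := by ring
      _ ≤ 2 * (E.e₂ - x) * ((E.e₁ - x) * (2 * (x - E.e₃))) :=
          mul_le_mul_of_nonneg_left hab (by linarith)
      _ = E.f x := by rw [f_eq]; ring

end EllCurve

/-! ### Monotone arcs of the oval -/

/-- A *monotone arc* of the bounded real oval of `E`: the part of the oval over the `x`-range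
`[lo, hi]`, `e₃ ≤ lo < hi ≤ e₂` with `lo, hi` real algebraic, on the sheet `y = +√f(x)`
(`upper = true`) or `y = −√f(x)` (`upper = false`), traversed with increasing `x`
(`forward = true`, from `(lo, y(lo))` to `(hi, y(hi))`) or with decreasing `x`. Its endpoints
are real algebraic points of `E` (2-torsion points when `lo = e₃` / `hi = e₂`).
[Chen 1977, §1.1; Kontsevich–Zagier 2001, §1.1] [folklore] -/
structure EllArc (E : EllCurve) where
  /-- Left end of the `x`-range. -/
  lo : ℝ
  /-- Right end of the `x`-range. -/
  hi : ℝ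
  isAlgebraic_lo : IsAlgebraic ℚ lo
  isAlgebraic_hi : IsAlgebraic ℚ hi
  e₃_le_lo : E.e₃ ≤ lo
  lo_lt_hi : lo < hi
  hi_le_e₂ : hi ≤ E.e₂
  /-- The sheet: `true` for `y = +√f(x)`, `false` for `y = −√f(x)`. -/
  upper : Bool
  /-- The orientation: `true` if the arc is traversed with increasing `x`. -/
  forward : Bool

namespace EllArc

variable {E : EllCurve} (γ : EllArc E)

/-- The sign of the sheet, `+1` (upper) or `−1` (lower). [folklore] -/
def sheetSign : ℝ := bif γ.upper then 1 else -1

/-- The orientation sign `σ`, `+1` (increasing `x`) or `−1` (decreasing `x`): `dx = σ |dx|`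
along the arc. [folklore] -/
def orSign : ℝ := bif γ.forward then 1 else -1

/-- The ordinate `y(x) = ±√f(x)` of the arc over the abscissa `x`. [Lawden 1989, §6.12]
[folklore] -/
def y (x : ℝ) : ℝ := γ.sheetSign * √(E.f x)

/-- The reversed arc `γ⁻¹` (same range and sheet, opposite orientation). [Chen 1977, §1.6]
[folklore] -/
def reverse : EllArc E := { γ with forward := !γ.forward }

/-- The arc of the route's items: the upper half of the oval from the 2-torsion point `(e₃, 0)`
to the 2-torsion point `(e₂, 0)`, traversed with increasing `x`. [folklore] -/
def upperHalf (E : EllCurve) : EllArc E where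
  lo := E.e₃
  hi := E.e₂
  isAlgebraic_lo := E.isAlgebraic_e₃
  isAlgebraic_hi := E.isAlgebraic_e₂
  e₃_le_lo := le_rfl
  lo_lt_hi := E.e₃_lt_e₂
  hi_le_e₂ := le_rfl
  upper := true
  forward := true

/-- `sheetSign = 1 ∨ sheetSign = -1`. [folklore] -/
theorem sheetSign_eq_or : γ.sheetSign = 1 ∨ γ.sheetSign = -1 := by
  unfold sheetSign; cases γ.upper <;> simp

/-- `orSign = 1 ∨ orSign = -1`. [folklore] -/
theorem orSign_eq_or : γ.orSign = 1 ∨ γ.orSign = -1 := by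
  unfold orSign; cases γ.forward <;> simp

/-- `sheetSign ≠ 0`. [folklore] -/
theorem sheetSign_ne_zero : γ.sheetSign ≠ 0 := by
  rcases γ.sheetSign_eq_or with h | h <;> simp [h]

/-- `sheetSign⁻¹ = sheetSign`. [folklore] -/
@[simp] theorem inv_sheetSign : γ.sheetSign⁻¹ = γ.sheetSign := by
  rcases γ.sheetSign_eq_or with h | h <;> simp [h]

/-- `orSign ^ n = 1 ∨ orSign ^ n = -1`. [folklore] -/
theorem orSign_pow_eq_or (n : ℕ) : γ.orSign ^ n = 1 ∨ γ.orSign ^ n = -1 := by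
  rcases γ.orSign_eq_or with h | h
  · simp [h]
  · rw [h]; exact neg_one_pow_eq_or ℝ n

/-- A point of the open `x`-range of an arc lies in the open oval range `(e₃, e₂)`. [folklore] -/
theorem mem_Ioo_of_mem_Ioo {x : ℝ} (hx : x ∈ Ioo γ.lo γ.hi) : E.e₃ < x ∧ x < E.e₂ :=
  ⟨γ.e₃_le_lo.trans_lt hx.1, hx.2.trans_le γ.hi_le_e₂⟩

/-- `y(x) ≠ 0` over the open range of the arc (no 2-torsion point inside). [folklore] -/
theorem y_ne_zero {x : ℝ} (hx : x ∈ Ioo γ.lo γ.hi) : γ.y x ≠ 0 := by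
  obtain ⟨h₃, h₂⟩ := γ.mem_Ioo_of_mem_Ioo hx
  exact mul_ne_zero γ.sheetSign_ne_zero (Real.sqrt_pos.2 (E.f_pos h₃ h₂)).ne'

/-- `y(x)² = f(x)` on the oval: the arc lies on `E`. [Lawden 1989, §6.12] [folklore] -/
theorem y_sq {x : ℝ} (hx : x ∈ Ioo γ.lo γ.hi) : γ.y x ^ 2 = E.f x := by
  obtain ⟨h₃, h₂⟩ := γ.mem_Ioo_of_mem_Ioo hx
  have hs : γ.sheetSign ^ 2 = 1 := by rcases γ.sheetSign_eq_or with h | h <;> simp [h]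
  rw [y, mul_pow, hs, one_mul, Real.sq_sqrt (E.f_pos h₃ h₂).le]

/-- `(y x)⁻¹ = sheetSign · (√f x)⁻¹`. [folklore] -/
theorem inv_y (x : ℝ) : (γ.y x)⁻¹ = γ.sheetSign * (√(E.f x))⁻¹ := by
  rw [y, mul_inv, inv_sheetSign]

/-- Reversal keeps the `x`-range. [folklore] -/
@[simp] theorem reverse_lo : γ.reverse.lo = γ.lo := rfl

/-- Reversal keeps the `x`-range. [folklore] -/
@[simp] theorem reverse_hi : γ.reverse.hi = γ.hi := rfl

/-- Reversal keeps the sheet. [folklore] -/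
@[simp] theorem reverse_upper : γ.reverse.upper = γ.upper := rfl

/-- Reversal flips the orientation. [Chen 1977, §1.6] [folklore] -/
@[simp] theorem reverse_forward : γ.reverse.forward = !γ.forward := rfl

/-- Reversal keeps the sheet sign. [folklore] -/
@[simp] theorem sheetSign_reverse : γ.reverse.sheetSign = γ.sheetSign := rfl

/-- Reversal flips the orientation sign. [Chen 1977, (1.6.2)] [folklore] -/
@[simp] theorem orSign_reverse : γ.reverse.orSign = -γ.orSign := by
  unfold orSign; rw [reverse_forward]; cases γ.forward <;> simp

/-- Reversal does not change the sheet: `y` is the same function. [folklore] -/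
@[simp] theorem y_reverse : γ.reverse.y = γ.y := rfl

/-- `(γ⁻¹)⁻¹ = γ`. [Chen 1977, §1.6] [folklore] -/
@[simp] theorem reverse_reverse : γ.reverse.reverse = γ := by
  cases γ; simp [reverse]

end EllArc

/-! ### Letters: the algebraic `1`-forms -/

/-- The letters of genus-one words: `pow j` is the form `x^j dx/y` (`j = 0`: `ω = dx/y`, first
kind; `j = 1`: `η = x dx/y`, second kind; `j = 2`: `x² dx/y`), and `third P`, `P = (x_P, y_P)`,
is the third-kind form `(y + y_P) dx / (2 (x − x_P) y)` (for `P ∈ E`: simple poles at `P` and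
`O` only, since `y + y_P` vanishes at `−P = (x_P, −y_P)`; its kernel is
`(y + y_P)/(2(x − x_P)) = ζ(z − z_P) − ζ(z) + ζ(z_P)`, `(x, y) = (℘z, ℘'z)`, by the
addition formula `ζ(u + v) = ζ(u) + ζ(v) + ½ (℘'u − ℘'v)/(℘u − ℘v)`).
[Lawden 1989, (6.8.4), §6.12–§6.14] [cite: Lawden1989, (6.8.4) and §6.14 (6.14.1)] -/
inductive EllLetter : Type
  /-- The form `x^j dx/y`. -/
  | pow (j : ℕ) : EllLetter
  /-- The third-kind form `(y + y_P) dx / (2 (x − x_P) y)` attached to `P = (x_P, y_P)`. -/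
  | third (P : ℝ × ℝ) : EllLetter

namespace EllLetter

variable {E : EllCurve}

/-- `ω = dx/y`, the form of the first kind. [Lawden 1989, §6.12] [folklore] -/
abbrev ω : EllLetter := pow 0

/-- `η = x dx/y`, the form of the second kind. [Lawden 1989, §6.13] [folklore] -/
abbrev η : EllLetter := pow 1

/-- The letter written in the coordinate `x` on the sheet of the arc `γ` — the density of the
form against `dx`: `x^j / y(x)` for `pow j`, `(y(x) + y_P)/(2 (x − x_P) y(x))` for `third P`,
with `y(x) = ±√f(x)`. [Lawden 1989, §6.12–§6.14; Kontsevich–Zagier 2001, §1.1] [folklore] -/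
def density (γ : EllArc E) : EllLetter → ℝ → ℝ
  | pow j, x => x ^ j / γ.y x
  | third P, x => (γ.y x + P.2) / (2 * (x - P.1) * γ.y x)

/-- A letter is *adapted* to the arc `γ` if it can be integrated along it inside the KZ
formalism: always for `x^j dx/y`; for a third-kind letter the point `P` must have real algebraic
coordinates and abscissa off the closed `x`-range `[lo, hi]` of the arc (so the form has no pole
on the closed arc). [Kontsevich–Zagier 2001, §1.1] [folklore] -/
def IsAdapted (γ : EllArc E) : EllLetter → Prop
  | pow _ => True
  | third P => IsAlgebraic ℚ P.1 ∧ IsAlgebraic ℚ P.2 ∧ P.1 ∉ Icc γ.lo γ.hi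

/-- The density of `x^j dx/y` is `x^j / y(x)`. [Lawden 1989, §6.12–§6.13] [folklore] -/
@[simp] theorem density_pow (γ : EllArc E) (j : ℕ) (x : ℝ) :
    (pow j).density γ x = x ^ j / γ.y x := rfl

/-- The density of the third-kind letter is `(y(x) + y_P)/(2 (x − x_P) y(x))`.
[Lawden 1989, (6.8.4), §6.14] [folklore] -/
@[simp] theorem density_third (γ : EllArc E) (P : ℝ × ℝ) (x : ℝ) :
    (third P).density γ x = (γ.y x + P.2) / (2 * (x - P.1) * γ.y x) := rfl

/-- Forms `x^j dx/y` are adapted to every arc. [folklore] -/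
@[simp] theorem isAdapted_pow (γ : EllArc E) (j : ℕ) : (pow j).IsAdapted γ := trivial

/-- Adaptedness of a third-kind letter, unfolded: algebraic coordinates, abscissa off
`[lo, hi]`. [folklore] -/
@[simp] theorem isAdapted_third_iff (γ : EllArc E) (P : ℝ × ℝ) :
    (third P).IsAdapted γ ↔ IsAlgebraic ℚ P.1 ∧ IsAlgebraic ℚ P.2 ∧ P.1 ∉ Icc γ.lo γ.hi :=
  Iff.rfl

/-- The density only depends on the sheet, not on the orientation. [folklore] -/
@[simp] theorem density_reverse (γ : EllArc E) (l : EllLetter) :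
    l.density γ.reverse = l.density γ := by
  cases l <;> rfl

/-- Adaptedness does not depend on the orientation. [folklore] -/
@[simp] theorem isAdapted_reverse_iff (γ : EllArc E) (l : EllLetter) :
    l.IsAdapted γ.reverse ↔ l.IsAdapted γ := by
  cases l <;> exact Iff.rfl

end EllLetter

/-! ### Words, the ordered simplex of an arc, the integrand -/

variable {E : EllCurve} {n : ℕ}

/-- A word `w = (φ₀, …, φ_{n−1})` is *adapted* to `γ` if all its letters are.
[Kontsevich–Zagier 2001, §1.1] [folklore] -/
def EllArc.Adapted (γ : EllArc E) (w : Fin n → EllLetter) : Prop := ∀ k, (w k).IsAdapted γ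

/-- Words in the forms `x^j dx/y` only are adapted to every arc. [folklore] -/
theorem EllArc.adapted_of_forall_eq_pow (γ : EllArc E) {w : Fin n → EllLetter}
    (h : ∀ k, ∃ j, w k = EllLetter.pow j) : γ.Adapted w := fun k => by
  obtain ⟨j, hj⟩ := h k
  rw [hj]; trivial

/-- Adaptedness of a word does not depend on the orientation. [folklore] -/
@[simp] theorem EllArc.adapted_reverse_iff (γ : EllArc E) (w : Fin n → EllLetter) :
    γ.reverse.Adapted w ↔ γ.Adapted w := by
  simp [EllArc.Adapted]

/-- **The domain**: the open ordered simplex of the arc in the `x`-coordinates,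
`{x ∈ ℝⁿ | lo < xᵢ < hi for all i, x₀ < x₁ < ⋯ < x_{n−1}}` for a forward arc and
`{…, x₀ > x₁ > ⋯ > x_{n−1}}` for a backward arc (coordinate `k` = position of the `k`-th letter
along the path). For `n = 0` this is the one-point space `ℝ⁰`.
[Chen 1977, §1.1 (1.1.1); Kontsevich–Zagier 2001, §1.1] [cite: KontsevichZagier2001, §1.1] -/
def ellDomain (γ : EllArc E) (n : ℕ) : Set (Fin n → ℝ) :=
  {x | (∀ i, γ.lo < x i) ∧ (∀ i, x i < γ.hi) ∧ bif γ.forward then StrictMono x else StrictAnti x}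

/-- **The integrand** `σⁿ ∏ₖ φₖ(xₖ)`: letter `k` written in the coordinate `xₖ` on the sheet of
`γ`, times the orientation sign `σ = ±1` of each `dx`. [Chen 1977, §1.1 (1.1.1);
Kontsevich–Zagier 2001, §1.1] [cite: KontsevichZagier2001, §1.1] -/
def ellIntegrand (γ : EllArc E) (w : Fin n → EllLetter) (x : Fin n → ℝ) : ℝ :=
  γ.orSign ^ n * ∏ k, (w k).density γ (x k)

/-- Membership in the domain, unfolded. [folklore] -/
theorem mem_ellDomain_iff (γ : EllArc E) (x : Fin n → ℝ) :
    x ∈ ellDomain γ n ↔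
      (∀ i, γ.lo < x i) ∧ (∀ i, x i < γ.hi) ∧ bif γ.forward then StrictMono x else StrictAnti x :=
  Iff.rfl

/-- The domain of a forward arc is the increasing simplex. [folklore] -/
theorem mem_ellDomain_iff_of_forward (γ : EllArc E) (h : γ.forward = true) (x : Fin n → ℝ) :
    x ∈ ellDomain γ n ↔ (∀ i, γ.lo < x i) ∧ (∀ i, x i < γ.hi) ∧ StrictMono x := by
  simp [ellDomain, h]

/-- The domain of a backward arc is the decreasing simplex. [folklore] -/
theorem mem_ellDomain_iff_of_not_forward (γ : EllArc E) (h : γ.forward = false)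
    (x : Fin n → ℝ) :
    x ∈ ellDomain γ n ↔ (∀ i, γ.lo < x i) ∧ (∀ i, x i < γ.hi) ∧ StrictAnti x := by
  simp [ellDomain, h]

/-- Coordinates of points of the domain lie in the open range `(lo, hi)`. [folklore] -/
theorem apply_mem_Ioo_of_mem_ellDomain (γ : EllArc E) {x : Fin n → ℝ} (hx : x ∈ ellDomain γ n)
    (k : Fin n) : x k ∈ Ioo γ.lo γ.hi :=
  ⟨hx.1 k, hx.2.1 k⟩

/-! ### The domain is `ℚ`-semialgebraic -/

/-- `{x | c < x i}` is `ℚ`-semialgebraic for a real algebraic `c` (the negativity set of the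
`ℚ`-semialgebraic function `c − x i`). [Kontsevich–Zagier 2001, §1.1; BCR 1998, §2.2] [folklore] -/
theorem isSemialgebraic_setOf_const_lt_apply {c : ℝ} (hc : IsAlgebraic ℚ c) (i : Fin n) :
    IsSemialgebraic ℚ {x : Fin n → ℝ | c < x i} := by
  have h : IsSemialgebraicFunOn ℚ (univ : Set (Fin n → ℝ)) (fun x => c - x i) :=
    (IsSemialgebraicFunOn.sub_holds (isSemialgebraicFunOn_const_of_isAlgebraic
      isSemialgebraic_univ hc) (isSemialgebraicFunOn_aeval isSemialgebraic_univ (X i))).congr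
      fun x _ => by simp
  convert h.isSemialgebraic_sep_neg using 1
  ext x
  simp [sub_neg]

/-- `{x | x i < c}` is `ℚ`-semialgebraic for a real algebraic `c`. [Kontsevich–Zagier 2001, §1.1;
BCR 1998, §2.2] [folklore] -/
theorem isSemialgebraic_setOf_apply_lt_const {c : ℝ} (hc : IsAlgebraic ℚ c) (i : Fin n) :
    IsSemialgebraic ℚ {x : Fin n → ℝ | x i < c} := by
  have h : IsSemialgebraicFunOn ℚ (univ : Set (Fin n → ℝ)) (fun x => x i - c) :=
    (IsSemialgebraicFunOn.sub_holds (isSemialgebraicFunOn_aeval isSemialgebraic_univ (X i))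
      (isSemialgebraicFunOn_const_of_isAlgebraic isSemialgebraic_univ hc)).congr
      fun x _ => by simp
  convert h.isSemialgebraic_sep_neg using 1
  ext x
  simp [sub_neg]

/-- The increasing simplex `{x | StrictMono x}` is `ℚ`-semialgebraic (finite intersection of
`x_j − x_i > 0`, `i < j`). [BCR 1998, Def. 2.1.4] [folklore] -/
theorem isSemialgebraic_setOf_strictMono (n : ℕ) :
    IsSemialgebraic ℚ {x : Fin n → ℝ | StrictMono x} := by
  have : {t : Fin n → ℝ | StrictMono t} = ⋂ p ∈ (Finset.univ.filter fun p : Fin n × Fin n =>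
      p.1 < p.2), {t | 0 < aeval t (X p.2 - X p.1 : MvPolynomial (Fin n) ℚ)} := by
    ext t
    simp only [mem_setOf_eq, Finset.mem_filter, Finset.mem_univ, true_and, mem_iInter,
      map_sub, aeval_X, sub_pos, Prod.forall]
    exact ⟨fun h a b hab => h hab, fun h a b hab => h a b hab⟩
  rw [this]
  exact IsSemialgebraic.biInter _ _ fun p _ => isSemialgebraic_setOf_eval_pos (k := ℚ) _

/-- The decreasing simplex `{x | StrictAnti x}` is `ℚ`-semialgebraic. [BCR 1998, Def. 2.1.4]
[folklore] -/
theorem isSemialgebraic_setOf_strictAnti (n : ℕ) :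
    IsSemialgebraic ℚ {x : Fin n → ℝ | StrictAnti x} := by
  have : {t : Fin n → ℝ | StrictAnti t} = ⋂ p ∈ (Finset.univ.filter fun p : Fin n × Fin n =>
      p.1 < p.2), {t | 0 < aeval t (X p.1 - X p.2 : MvPolynomial (Fin n) ℚ)} := by
    ext t
    simp only [mem_setOf_eq, Finset.mem_filter, Finset.mem_univ, true_and, mem_iInter,
      map_sub, aeval_X, sub_pos, Prod.forall]
    exact ⟨fun h a b hab => h hab, fun h a b hab => h a b hab⟩
  rw [this]
  exact IsSemialgebraic.biInter _ _ fun p _ => isSemialgebraic_setOf_eval_pos (k := ℚ) _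

/-- **The domain is `ℚ`-semialgebraic**: the endpoints are real algebraic, hence `ℚ`-definable.
[Kontsevich–Zagier 2001, §1.1 ("rational" may be replaced by "algebraic"); BCR 1998, §2.2]
[cite: KontsevichZagier2001, §1.1] -/
theorem isSemialgebraic_ellDomain (γ : EllArc E) (n : ℕ) : IsSemialgebraic ℚ (ellDomain γ n) := by
  have h1 : IsSemialgebraic ℚ {x : Fin n → ℝ | ∀ i, γ.lo < x i} := by
    have : {x : Fin n → ℝ | ∀ i, γ.lo < x i} = ⋂ i ∈ (Finset.univ : Finset (Fin n)),
        {x | γ.lo < x i} := by ext; simp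
    rw [this]
    exact IsSemialgebraic.biInter _ _ fun i _ =>
      isSemialgebraic_setOf_const_lt_apply γ.isAlgebraic_lo i
  have h2 : IsSemialgebraic ℚ {x : Fin n → ℝ | ∀ i, x i < γ.hi} := by
    have : {x : Fin n → ℝ | ∀ i, x i < γ.hi} = ⋂ i ∈ (Finset.univ : Finset (Fin n)),
        {x | x i < γ.hi} := by ext; simp
    rw [this]
    exact IsSemialgebraic.biInter _ _ fun i _ =>
      isSemialgebraic_setOf_apply_lt_const γ.isAlgebraic_hi i
  have h3 : IsSemialgebraic ℚ
      {x : Fin n → ℝ | bif γ.forward then StrictMono x else StrictAnti x} := by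
    cases γ.forward
    · exact isSemialgebraic_setOf_strictAnti n
    · exact isSemialgebraic_setOf_strictMono n
  have : ellDomain γ n = {x | ∀ i, γ.lo < x i} ∩ {x | ∀ i, x i < γ.hi} ∩
      {x : Fin n → ℝ | bif γ.forward then StrictMono x else StrictAnti x} := by
    ext x; simp [ellDomain, and_assoc]
  rw [this]
  exact (h1.inter h2).inter h3

/-- The domain is Lebesgue measurable (semialgebraic sets are Borel). [folklore] -/
theorem measurableSet_ellDomain (γ : EllArc E) (n : ℕ) : MeasurableSet (ellDomain γ n) :=
  IsSemialgebraic.measurableSet_holds (isSemialgebraic_ellDomain γ n)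

/-! ### The integrand is `ℚ`-semialgebraic on the domain -/

section Semialgebraic

variable {s : Set (Fin n → ℝ)}

/-- `x ↦ f(x k)` is `ℚ`-semialgebraic on any `ℚ`-semialgebraic `s ⊆ ℝⁿ` (the roots `eᵢ` are
real algebraic constants). [BCR 1998, Prop. 2.2.6; Kontsevich–Zagier 2001, §1.1] [folklore] -/
theorem isSemialgebraicFunOn_f_apply (hs : IsSemialgebraic ℚ s) (E : EllCurve) (k : Fin n) :
    IsSemialgebraicFunOn ℚ s (fun x => E.f (x k)) := by
  have hX : IsSemialgebraicFunOn ℚ s (fun x => x k) :=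
    (isSemialgebraicFunOn_aeval hs (X k)).congr fun x _ => by simp
  have h4 : IsSemialgebraicFunOn ℚ s (fun _ => (4 : ℝ)) := by
    simpa using isSemialgebraicFunOn_natCast (k := ℚ) (R := ℝ) hs 4
  have h₁ := IsSemialgebraicFunOn.sub_holds hX
    (isSemialgebraicFunOn_const_of_isAlgebraic hs E.isAlgebraic_e₁)
  have h₂ := IsSemialgebraicFunOn.sub_holds hX
    (isSemialgebraicFunOn_const_of_isAlgebraic hs E.isAlgebraic_e₂)
  have h₃ := IsSemialgebraicFunOn.sub_holds hX
    (isSemialgebraicFunOn_const_of_isAlgebraic hs E.isAlgebraic_e₃)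
  have h := IsSemialgebraicFunOn.mul_holds
    (IsSemialgebraicFunOn.mul_holds (IsSemialgebraicFunOn.mul_holds h4 h₁) h₂) h₃
  exact h.congr fun x _ => by simp [EllCurve.f]

/-- `x ↦ y(x k) = ±√f(x k)` is `ℚ`-semialgebraic. [BCR 1998, Prop. 2.2.6] [folklore] -/
theorem isSemialgebraicFunOn_y_apply (hs : IsSemialgebraic ℚ s) (γ : EllArc E) (k : Fin n) :
    IsSemialgebraicFunOn ℚ s (fun x => γ.y (x k)) := by
  have h := IsSemialgebraicFunOn.sqrt_holds (isSemialgebraicFunOn_f_apply hs E k)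
  rcases γ.sheetSign_eq_or with hσ | hσ
  · exact h.congr fun x _ => by simp [EllArc.y, hσ]
  · exact h.neg.congr fun x _ => by simp [EllArc.y, hσ]

/-- Each letter, written in the coordinate `x k`, is `ℚ`-semialgebraic on any `ℚ`-semialgebraic
set whose `k`-th coordinates stay in the open range `(lo, hi)` (quotients with non-vanishing
denominators: `y ≠ 0` inside the oval range, `x − x_P ≠ 0` as the pole is off `[lo, hi]`).
[BCR 1998, Prop. 2.2.6; Kontsevich–Zagier 2001, §1.1] [folklore] -/
theorem isSemialgebraicFunOn_density_apply (hs : IsSemialgebraic ℚ s) (γ : EllArc E)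
    (l : EllLetter) (hl : l.IsAdapted γ) (k : Fin n) (hk : ∀ x ∈ s, x k ∈ Ioo γ.lo γ.hi) :
    IsSemialgebraicFunOn ℚ s (fun x => l.density γ (x k)) := by
  have hy := isSemialgebraicFunOn_y_apply hs γ k
  have hy0 : ∀ x ∈ s, γ.y (x k) ≠ 0 := fun x hx => γ.y_ne_zero (hk x hx)
  have hX : IsSemialgebraicFunOn ℚ s (fun x => x k) :=
    (isSemialgebraicFunOn_aeval hs (X k)).congr fun x _ => by simp
  cases l with
  | pow j =>
    have hXj : IsSemialgebraicFunOn ℚ s (fun x => x k ^ j) :=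
      (isSemialgebraicFunOn_aeval hs (X k ^ j)).congr fun x _ => by simp
    exact (hXj.div hy hy0).congr fun x _ => by simp
  | third P =>
    obtain ⟨hP1, hP2, hP⟩ := hl
    have hnum :=
      IsSemialgebraicFunOn.add_holds hy (isSemialgebraicFunOn_const_of_isAlgebraic hs hP2)
    have h2 : IsSemialgebraicFunOn ℚ s (fun _ => (2 : ℝ)) := by
      simpa using isSemialgebraicFunOn_natCast (k := ℚ) (R := ℝ) hs 2
    have hden := IsSemialgebraicFunOn.mul_holds (IsSemialgebraicFunOn.mul_holds h2
      (IsSemialgebraicFunOn.sub_holds hX (isSemialgebraicFunOn_const_of_isAlgebraic hs hP1))) hy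
    have hden0 : ∀ x ∈ s, 2 * (x k - P.1) * γ.y (x k) ≠ 0 := fun x hx =>
      mul_ne_zero (mul_ne_zero two_ne_zero (sub_ne_zero.2 fun h =>
        hP (h ▸ Ioo_subset_Icc_self (hk x hx)))) (hy0 x hx)
    exact (hnum.div hden fun x hx => by simpa using hden0 x hx).congr fun x _ => by simp

/-- Finite products of `ℚ`-semialgebraic functions are `ℚ`-semialgebraic (induction on
`IsSemialgebraicFunOn.mul_holds`). [BCR 1998, Prop. 2.2.6] [folklore] -/
theorem isSemialgebraicFunOn_finset_prod {ι : Type*} (hs : IsSemialgebraic ℚ s) (t : Finset ι)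
    (F : ι → (Fin n → ℝ) → ℝ) (hF : ∀ i ∈ t, IsSemialgebraicFunOn ℚ s (F i)) :
    IsSemialgebraicFunOn ℚ s (fun x => ∏ i ∈ t, F i x) := by
  classical
  induction t using Finset.induction_on with
  | empty => simpa using isSemialgebraicFunOn_natCast (k := ℚ) (R := ℝ) hs 1
  | @insert a t ha ih =>
    have h := IsSemialgebraicFunOn.mul_holds (hF a (Finset.mem_insert_self a t))
      (ih fun i hi => hF i (Finset.mem_insert_of_mem hi))
    exact h.congr fun x _ => by simp [Finset.prod_insert ha]

/-- **The integrand is `ℚ`-semialgebraic on the domain.** [Kontsevich–Zagier 2001, §1.1;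
BCR 1998, Prop. 2.2.6] [cite: KontsevichZagier2001, §1.1] -/
theorem isSemialgebraicFunOn_ellIntegrand (γ : EllArc E) (w : Fin n → EllLetter)
    (hw : γ.Adapted w) : IsSemialgebraicFunOn ℚ (ellDomain γ n) (ellIntegrand γ w) := by
  have hs := isSemialgebraic_ellDomain γ n
  have hprod := isSemialgebraicFunOn_finset_prod hs Finset.univ
    (fun k x => (w k).density γ (x k)) fun k _ =>
      isSemialgebraicFunOn_density_apply hs γ (w k) (hw k) k fun x hx =>
        apply_mem_Ioo_of_mem_ellDomain γ hx k
  have hc : IsSemialgebraicFunOn ℚ (ellDomain γ n) (fun _ => γ.orSign ^ n) := by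
    rcases γ.orSign_pow_eq_or n with h | h <;> rw [h]
    · simpa using isSemialgebraicFunOn_natCast (k := ℚ) (R := ℝ) hs 1
    · exact (isSemialgebraicFunOn_natCast (k := ℚ) (R := ℝ) hs 1).neg.congr fun x _ => by simp
  exact (IsSemialgebraicFunOn.mul_holds hc hprod).congr fun x _ => by simp [ellIntegrand]

end Semialgebraic

/-! ### Absolute convergence -/

/-- `(√(x − c))⁻¹` is integrable on `(c, d)`: it is the derivative of `2 √(x − c)`, continuous
on `[c, d]` (`intervalIntegral.integrableOn_deriv_of_nonneg`). [folklore] -/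
theorem integrableOn_inv_sqrt_sub_left (c d : ℝ) :
    IntegrableOn (fun x : ℝ => (√(x - c))⁻¹) (Ioo c d) := by
  have h := intervalIntegral.integrableOn_deriv_of_nonneg (g := fun x => 2 * √(x - c))
    (g' := fun x => (√(x - c))⁻¹) (a := c) (b := d) (by fun_prop) ?_ ?_
  · exact h.mono_set Ioo_subset_Ioc_self
  · intro x hx
    have hx0 : x - c ≠ 0 := (sub_pos.2 hx.1).ne'
    have hs : √(x - c) ≠ 0 := Real.sqrt_ne_zero'.2 (sub_pos.2 hx.1)
    refine ((((hasDerivAt_id x).sub_const c).sqrt hx0).const_mul 2).congr_deriv ?_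
    simp only [id]
    field_simp
  · intro x _; positivity

/-- `(√(d − x))⁻¹` is integrable on `(c, d)`: it is the derivative of `−2 √(d − x)`. [folklore] -/
theorem integrableOn_inv_sqrt_sub_right (c d : ℝ) :
    IntegrableOn (fun x : ℝ => (√(d - x))⁻¹) (Ioo c d) := by
  have h := intervalIntegral.integrableOn_deriv_of_nonneg (g := fun x => -2 * √(d - x))
    (g' := fun x => (√(d - x))⁻¹) (a := c) (b := d) (by fun_prop) ?_ ?_
  · exact h.mono_set Ioo_subset_Ioc_self
  · intro x hx
    have hx0 : d - x ≠ 0 := (sub_pos.2 hx.2).ne'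
    have hs : √(d - x) ≠ 0 := Real.sqrt_ne_zero'.2 (sub_pos.2 hx.2)
    refine ((((hasDerivAt_id x).const_sub d).sqrt hx0).const_mul (-2)).congr_deriv ?_
    simp only [id]
    field_simp
  · intro x _; positivity

namespace EllCurve

/-- **`1/√f` is integrable on the oval range `(e₃, e₂)`** (inverse-square-root singularities at
the 2-torsion abscissae only): `(√f x)⁻¹ ≤ K^{-1/2} ((√(x − e₃))⁻¹ + (√(e₂ − x))⁻¹)` with
`K = 2 (e₁ − e₂)(e₂ − e₃)`. This is the absolute convergence of the real period
`ω₁/2 = ∫_{e₃}^{e₂} dx/√f`. [Lawden 1989, §6.12 (6.12.25); Kontsevich–Zagier 2001, §1.1]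
[folklore] -/
theorem integrableOn_inv_sqrt_f (E : EllCurve) :
    IntegrableOn (fun x => (√(E.f x))⁻¹) (Ioo E.e₃ E.e₂) := by
  set K : ℝ := 2 * (E.e₁ - E.e₂) * (E.e₂ - E.e₃) with hK_def
  have hK : 0 < K :=
    mul_pos (mul_pos two_pos (sub_pos.2 E.e₂_lt_e₁)) (sub_pos.2 E.e₃_lt_e₂)
  have hmaj : IntegrableOn
      (fun x => (√K)⁻¹ * ((√(x - E.e₃))⁻¹ + (√(E.e₂ - x))⁻¹)) (Ioo E.e₃ E.e₂) :=
    ((integrableOn_inv_sqrt_sub_left _ _).add (integrableOn_inv_sqrt_sub_right _ _)).const_mul _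
  refine Integrable.mono' hmaj ?_ ?_
  · exact (E.continuous_f.sqrt.measurable.inv).aestronglyMeasurable
  · filter_upwards [ae_restrict_mem measurableSet_Ioo] with x hx
    obtain ⟨h₃, h₂⟩ := hx
    rw [Real.norm_of_nonneg (inv_nonneg.2 (Real.sqrt_nonneg _))]
    have hA : 0 ≤ (√(x - E.e₃))⁻¹ := inv_nonneg.2 (Real.sqrt_nonneg _)
    have hB : 0 ≤ (√(E.e₂ - x))⁻¹ := inv_nonneg.2 (Real.sqrt_nonneg _)
    have hKi : 0 ≤ (√K)⁻¹ := inv_nonneg.2 (Real.sqrt_nonneg _)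
    rcases le_total (x - E.e₃) (E.e₂ - x) with h | h
    · have hfx := (E.const_mul_le_f h₃ h₂).1 h
      calc (√(E.f x))⁻¹ ≤ (√(K * (x - E.e₃)))⁻¹ :=
            inv_anti₀ (Real.sqrt_pos.2 (mul_pos hK (sub_pos.2 h₃))) (Real.sqrt_le_sqrt hfx)
        _ = (√K)⁻¹ * (√(x - E.e₃))⁻¹ := by rw [Real.sqrt_mul hK.le, mul_inv]
        _ ≤ (√K)⁻¹ * ((√(x - E.e₃))⁻¹ + (√(E.e₂ - x))⁻¹) :=
            mul_le_mul_of_nonneg_left (le_add_of_nonneg_right hB) hKi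
    · have hfx := (E.const_mul_le_f h₃ h₂).2 h
      calc (√(E.f x))⁻¹ ≤ (√(K * (E.e₂ - x)))⁻¹ :=
            inv_anti₀ (Real.sqrt_pos.2 (mul_pos hK (sub_pos.2 h₂))) (Real.sqrt_le_sqrt hfx)
        _ = (√K)⁻¹ * (√(E.e₂ - x))⁻¹ := by rw [Real.sqrt_mul hK.le, mul_inv]
        _ ≤ (√K)⁻¹ * ((√(x - E.e₃))⁻¹ + (√(E.e₂ - x))⁻¹) :=
            mul_le_mul_of_nonneg_left (le_add_of_nonneg_left hA) hKi

end EllCurve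

/-- `1/y = ±1/√f` is integrable on the open range of the arc. [folklore] -/
theorem EllArc.integrableOn_inv_y (γ : EllArc E) :
    IntegrableOn (fun x => (γ.y x)⁻¹) (Ioo γ.lo γ.hi) := by
  have h : IntegrableOn (fun x => γ.sheetSign * (√(E.f x))⁻¹) (Ioo γ.lo γ.hi) :=
    ((EllCurve.integrableOn_inv_sqrt_f E).mono_set
      (Ioo_subset_Ioo γ.e₃_le_lo γ.hi_le_e₂)).const_mul γ.sheetSign
  exact h.congr_fun (fun x _ => (γ.inv_y x).symm) measurableSet_Ioo

/-- **Every adapted letter is absolutely integrable on the open range of the arc**: `x^j / y` is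
(bounded continuous) × `1/y`; `(y + y_P)/(2(x − x_P) y) = 1/(2(x − x_P)) + y_P/(2(x − x_P)) · 1/y`
with `x − x_P` bounded away from `0` on `[lo, hi]`. [Kontsevich–Zagier 2001, §1.1] [folklore] -/
theorem integrableOn_density (γ : EllArc E) (l : EllLetter) (hl : l.IsAdapted γ) :
    IntegrableOn (fun x => l.density γ x) (Ioo γ.lo γ.hi) := by
  have hy := γ.integrableOn_inv_y
  cases l with
  | pow j =>
    refine (IntegrableOn.continuousOn_mul_of_subset (continuous_pow j).continuousOn hy
      isCompact_Icc measurableSet_Ioo Ioo_subset_Icc_self).congr_fun (fun x _ => ?_)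
      measurableSet_Ioo
    simp [div_eq_mul_inv]
  | third P =>
    obtain ⟨-, -, hP⟩ := hl
    have hne : ∀ x ∈ Icc γ.lo γ.hi, 2 * (x - P.1) ≠ 0 := fun x hx =>
      mul_ne_zero two_ne_zero (sub_ne_zero.2 fun h => hP (h ▸ hx))
    have hcont1 : ContinuousOn (fun x => (2 * (x - P.1))⁻¹) (Icc γ.lo γ.hi) :=
      ContinuousOn.inv₀ (by fun_prop) hne
    have hcont2 : ContinuousOn (fun x => P.2 * (2 * (x - P.1))⁻¹) (Icc γ.lo γ.hi) :=
      continuousOn_const.mul hcont1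
    have h1 : IntegrableOn (fun x => (2 * (x - P.1))⁻¹) (Ioo γ.lo γ.hi) :=
      hcont1.integrableOn_Icc.mono_set Ioo_subset_Icc_self
    have h2 : IntegrableOn (fun x => P.2 * (2 * (x - P.1))⁻¹ * (γ.y x)⁻¹) (Ioo γ.lo γ.hi) :=
      IntegrableOn.continuousOn_mul_of_subset hcont2 hy isCompact_Icc measurableSet_Ioo
        Ioo_subset_Icc_self
    refine (h1.add h2).congr_fun (fun x hx => ?_) measurableSet_Ioo
    have hy0 : γ.y x ≠ 0 := γ.y_ne_zero hx
    have hx0 : x - P.1 ≠ 0 := sub_ne_zero.2 fun h => hP (h ▸ Ioo_subset_Icc_self hx)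
    simp only [Pi.add_apply, EllLetter.density_third]
    field_simp

/-- **Absolute convergence of the iterated integral**: the integrand is integrable on the
domain — on the box `(lo, hi)ⁿ ⊇ domain` it is `σⁿ` times a product of one-variable integrable
functions (`integrableOn_density`, Tonelli/Fubini `MeasureTheory.Integrable.fintype_prod`).
[Chen 1977, §1.1; Kontsevich–Zagier 2001, §1.1] [cite: KontsevichZagier2001, §1.1] -/
theorem integrableOn_ellIntegrand (γ : EllArc E) (w : Fin n → EllLetter) (hw : γ.Adapted w) :
    IntegrableOn (ellIntegrand γ w) (ellDomain γ n) := by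
  have hG : Integrable (fun x : Fin n → ℝ =>
      ∏ k, (Ioo γ.lo γ.hi).indicator (fun t => (w k).density γ t) (x k))
      (volume : Measure (Fin n → ℝ)) :=
    Integrable.fintype_prod (μ := fun _ : Fin n => (volume : Measure ℝ))
      (f := fun k => (Ioo γ.lo γ.hi).indicator fun t => (w k).density γ t)
      fun k => (integrableOn_density γ (w k) (hw k)).integrable_indicator measurableSet_Ioo
  refine ((hG.const_mul (γ.orSign ^ n)).integrableOn).congr_fun (fun x hx => ?_)
    (measurableSet_ellDomain γ n)
  simp only [ellIntegrand]
  congr 1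
  exact Finset.prod_congr rfl fun k _ =>
    Set.indicator_of_mem (apply_mem_Ioo_of_mem_ellDomain γ hx k) _

/-! ### The representation -/

/-- **`ellIterRep γ w`** — the genus-one iterated integral `∫_γ φ₀ φ₁ ⋯ φ_{n−1}` of a word of
algebraic `1`-forms along a monotone arc of the real oval, as an effective Kontsevich–Zagier
period datum `KZ.IntegralRep n`: domain the open simplex of the arc in the `x`-coordinates
(ordered by the arc), integrand `σⁿ ∏ₖ φₖ(xₖ)`; `ℚ`-semialgebraicity and absolute convergence
are proved (`isSemialgebraic_ellDomain`, `isSemialgebraicFunOn_ellIntegrand`,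
`integrableOn_ellIntegrand`). The hypothesis `hw` says that the third-kind letters of `w` have
algebraic poles off the closed arc. Companion of `KZ.mzvRep`.
[Chen 1977, §1.1 (1.1.1); Kontsevich–Zagier 2001, §1.1] [cite: KontsevichZagier2001, §1.1] -/
def ellIterRep (γ : EllArc E) (w : Fin n → EllLetter) (hw : γ.Adapted w) : IntegralRep n where
  domain := ellDomain γ n
  integrand := ellIntegrand γ w
  isSemialgebraic_domain := isSemialgebraic_ellDomain γ n
  isSemialgebraicFunOn_integrand := isSemialgebraicFunOn_ellIntegrand γ w hw
  integrableOn := integrableOn_ellIntegrand γ w hw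

/-! ### API -/

/-- The domain of `ellIterRep`, unfolded. [folklore] -/
@[simp] theorem ellIterRep_domain (γ : EllArc E) (w : Fin n → EllLetter) (hw : γ.Adapted w) :
    (ellIterRep γ w hw).domain = ellDomain γ n := rfl

/-- The integrand of `ellIterRep`, unfolded. [folklore] -/
@[simp] theorem ellIterRep_integrand (γ : EllArc E) (w : Fin n → EllLetter) (hw : γ.Adapted w) :
    (ellIterRep γ w hw).integrand = ellIntegrand γ w := rfl

/-- The value of `ellIterRep` is the integral of `σⁿ ∏ φₖ(xₖ)` over the ordered simplex of the
arc: the iterated integral `∫_γ φ₀ ⋯ φ_{n−1}`. [Chen 1977, §1.1 (1.1.1); Kontsevich–Zagier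
2001, §1.1] [folklore] -/
theorem ellIterRep_value (γ : EllArc E) (w : Fin n → EllLetter) (hw : γ.Adapted w) :
    (ellIterRep γ w hw).value = ∫ x in ellDomain γ n, ellIntegrand γ w x := rfl

/-- The integrand does not depend on the adaptedness proof, and two adapted words with the same
letters give the same representation. [folklore] -/
theorem ellIterRep_congr (γ : EllArc E) {w w' : Fin n → EllLetter} (h : w = w')
    (hw : γ.Adapted w) (hw' : γ.Adapted w') : ellIterRep γ w hw = ellIterRep γ w' hw' := by
  subst h; rfl

/-- **Non-vacuity**: the domain of every arc is non-empty (equally spaced increasing, resp.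
decreasing, abscissae in `(lo, hi)`). [folklore] -/
theorem ellDomain_nonempty (γ : EllArc E) (n : ℕ) : (ellDomain γ n).Nonempty := by
  have hd : 0 < γ.hi - γ.lo := sub_pos.2 γ.lo_lt_hi
  have hN : (0 : ℝ) < n + 1 := by positivity
  -- `u i = (i + 1)/(n + 1) ∈ (0, 1)`, strictly increasing
  set u : Fin n → ℝ := fun i => ((i : ℕ) + 1 : ℝ) / (n + 1) with hu
  have hu0 : ∀ i, 0 < u i := fun i => by positivity
  have hu1 : ∀ i, u i < 1 := fun i => by
    rw [hu, div_lt_one hN]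
    exact_mod_cast Nat.succ_lt_succ i.isLt
  have humono : StrictMono u := fun i j hij => by
    simp only [hu]
    exact div_lt_div_of_pos_right (by exact_mod_cast Nat.succ_lt_succ hij) hN
  cases hf : γ.forward
  · refine ⟨fun i => γ.hi - (γ.hi - γ.lo) * u i, fun i => ?_, fun i => ?_, ?_⟩
    · have := mul_lt_mul_of_pos_left (hu1 i) hd
      linarith
    · have := mul_pos hd (hu0 i)
      linarith
    · simp only [hf, cond_false]
      exact fun i j hij => by
        have := mul_lt_mul_of_pos_left (humono hij) hd
        dsimp only; linarith
  · refine ⟨fun i => γ.lo + (γ.hi - γ.lo) * u i, fun i => ?_, fun i => ?_, ?_⟩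
    · have := mul_pos hd (hu0 i)
      linarith
    · have := mul_lt_mul_of_pos_left (hu1 i) hd
      linarith
    · simp only [hf, cond_true]
      exact fun i j hij => by
        have := mul_lt_mul_of_pos_left (humono hij) hd
        dsimp only; linarith

/-! ### Path reversal (pointwise) -/

/-- `x ∘ Fin.rev` is strictly increasing iff `x` is strictly decreasing. [folklore] -/
theorem strictMono_comp_rev_iff {x : Fin n → ℝ} : StrictMono (x ∘ Fin.rev) ↔ StrictAnti x := by
  constructor
  · intro h i j hij
    have := h (Fin.rev_lt_rev.2 hij)
    simpa using this
  · intro h i j hij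
    exact h (Fin.rev_lt_rev.2 hij)

/-- `x ∘ Fin.rev` is strictly decreasing iff `x` is strictly increasing. [folklore] -/
theorem strictAnti_comp_rev_iff {x : Fin n → ℝ} : StrictAnti (x ∘ Fin.rev) ↔ StrictMono x := by
  constructor
  · intro h i j hij
    have := h (Fin.rev_lt_rev.2 hij)
    simpa using this
  · intro h i j hij
    exact h (Fin.rev_lt_rev.2 hij)

/-- **Reversal of the domain**: `x` lies in the simplex of `γ⁻¹` iff the reversed tuple
`x ∘ Fin.rev` lies in the simplex of `γ` (the coordinate reversal is a volume-preserving linear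
change of variables with `|det| = 1`). [Chen 1977, (1.6.2); Goncharov 2005, Prop. 2.1] [folklore] -/
theorem mem_ellDomain_reverse_iff (γ : EllArc E) (x : Fin n → ℝ) :
    x ∈ ellDomain γ.reverse n ↔ x ∘ Fin.rev ∈ ellDomain γ n := by
  have hlo : (∀ i, γ.lo < (x ∘ Fin.rev) i) ↔ ∀ i, γ.lo < x i :=
    ⟨fun h i => by simpa using h (Fin.rev i), fun h i => h _⟩
  have hhi : (∀ i, (x ∘ Fin.rev) i < γ.hi) ↔ ∀ i, x i < γ.hi :=
    ⟨fun h i => by simpa using h (Fin.rev i), fun h i => h _⟩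
  simp only [mem_ellDomain_iff, EllArc.reverse_lo, EllArc.reverse_hi, EllArc.reverse_forward,
    hlo, hhi]
  cases γ.forward
  · simp [strictAnti_comp_rev_iff]
  · simp [strictMono_comp_rev_iff]

/-- **Reversal of the integrand**: the integrand of `γ⁻¹` for the word `w` at `x` is `(−1)ⁿ`
times the integrand of `γ` for the reversed word `w ∘ Fin.rev` at the reversed tuple
`x ∘ Fin.rev` — the pointwise content of `∫_{γ⁻¹} φ₀ ⋯ φ_{n−1} = (−1)ⁿ ∫_γ φ_{n−1} ⋯ φ₀`.
[Chen 1977, (1.6.2); Goncharov 2005, Prop. 2.1] [cite: Chen1977, (1.6.2)] -/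
theorem ellIntegrand_reverse (γ : EllArc E) (w : Fin n → EllLetter) (x : Fin n → ℝ) :
    ellIntegrand γ.reverse w x = (-1) ^ n * ellIntegrand γ (w ∘ Fin.rev) (x ∘ Fin.rev) := by
  have hprod : ∏ k, (w k).density γ (x k) =
      ∏ k, ((w ∘ Fin.rev) k).density γ ((x ∘ Fin.rev) k) :=
    (Fintype.prod_equiv Fin.revPerm (fun k => ((w ∘ Fin.rev) k).density γ ((x ∘ Fin.rev) k))
      (fun k => (w k).density γ (x k)) fun k => by simp).symm
  simp only [ellIntegrand, EllArc.orSign_reverse, EllLetter.density_reverse, neg_pow γ.orSign,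
    hprod]
  ring

/-- Reversal is an involution on words-with-arcs data: `Adapted` is preserved. [folklore] -/
theorem EllArc.Adapted.comp_rev {γ : EllArc E} {w : Fin n → EllLetter} (hw : γ.Adapted w) :
    γ.Adapted (w ∘ Fin.rev) := fun k => hw (Fin.rev k)

/-! ### Examples -/

/-- The word `ωωη = (dx/y, dx/y, x dx/y)` along the upper half-oval gives a representation of
dimension `3` whose integrand is `x₂/(y₀ y₁ y₂)`, `yᵢ = √f(xᵢ)` — the `I(ωωη)` of the route's
item DepthThreeFamily. [folklore] -/
example (E : EllCurve) (x : Fin 3 → ℝ) :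
    (ellIterRep (EllArc.upperHalf E) ![EllLetter.ω, EllLetter.ω, EllLetter.η]
        ((EllArc.upperHalf E).adapted_of_forall_eq_pow fun k => by
          fin_cases k <;> exact ⟨_, rfl⟩)).integrand x =
      x 2 / (√(E.f (x 0)) * √(E.f (x 1)) * √(E.f (x 2))) := by
  simp [ellIntegrand, EllArc.orSign, EllArc.upperHalf, EllArc.y, EllArc.sheetSign,
    Fin.prod_univ_three]
  ring

/-- The domain of a word of length `2` along the upper half-oval is the triangle
`{e₃ < x₀ < x₁ < e₂}` of the route's items KummerFamily / KummerLogTwo. [folklore] -/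
example (E : EllCurve) (x : Fin 2 → ℝ) :
    x ∈ ellDomain (EllArc.upperHalf E) 2 ↔ E.e₃ < x 0 ∧ x 0 < x 1 ∧ x 1 < E.e₂ := by
  rw [mem_ellDomain_iff_of_forward _ rfl]
  simp only [EllArc.upperHalf, Fin.forall_fin_two]
  constructor
  · rintro ⟨⟨h0, -⟩, ⟨-, h1⟩, hm⟩
    exact ⟨h0, hm (show (0 : Fin 2) < 1 by decide), h1⟩
  · rintro ⟨h0, h01, h1⟩
    refine ⟨⟨h0, h0.trans h01⟩, ⟨h01.trans h1, h1⟩, ?_⟩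
    exact Fin.strictMono_iff_lt_succ.2 fun i => by
      fin_cases i; simpa using h01

end KZ

end Literature.NumberTheory.Transcendental
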